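import Summits.AtomisticToContinuum.BoseEinsteinCondensation.Theorems.BECTangentRigidityRigidMomentumBoundStubInsertionBound
import Summits.AtomisticToContinuum.BoseEinsteinCondensation.Theorems.BECTangentRigidityRigidMomentumBoundStubFirstVariation
import Summits.AtomisticToContinuum.BoseEinsteinCondensation.Theorems.BECTangentRigidityRigidMomentumBoundStubSturmPackage
import Summits.AtomisticToContinuum.BoseEinsteinCondensation.Theorems.BECTangentRigidityRigidMomentumBoundStubFullSliceEnergy1D
import Summits.AtomisticToContinuum.BoseEinsteinCondensation.Theorems.BECTangentRigidityRigidMomentumBoundStubMarginalLimitExtraction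
import Summits.AtomisticToContinuum.BoseEinsteinCondensation.Theorems.BECTangentRigidityRigidMomentumBoundStubSliceStability
import Summits.AtomisticToContinuum.BoseEinsteinCondensation.Theorems.BECTangentRigidityRigidMomentumBoundStubSlabNonConcentration
import Literature.MathematicalPhysics.QuantumManyBody.OneCoordinateMarginalNearWall
import Literature.MathematicalPhysics.QuantumManyBody.BoseGasThermodynamicLimitProofs
import Literature.MathematicalPhysics.QuantumManyBody.BoseGasDirichletWall
import HarnessLib

/-!
# Crux `RigidMomentumBound`, line `registered`: the near-wall energy bound R3 (`stub_nearWallEnergy`)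

For every repulsive finite-range pair potential, at small density, for all `ε, κ > 0`, eventually in `N`,
every box `L'` of the window `[L_N, (1+κ/N)L_N]` admits, for every small `w`, a near-minimiser whose energy
in the configurations with a particle coordinate within `2w` of its right wall is `≤ w·εN²/(κL_N³)` (the
wall flux is `o(N)`). Proof = the glue `nearWallGlue` (section `Glue`; hypotheses F3 insertion bound, F4
slab non-concentration, F6 Sturm package, G4 marginal limit package, G5 full-slice post-processing; constants
`μ := max (13000ρR₀+2) (π²/s₁²+1)`, `s₀ := π/(2√μ)`, `θ := ερ/(1728κμ√μ)`, `w₀ := min (s₀/8) (min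
(1/√(32(E'+1))) (L'/4))`) applied to the landed stubs of the line. -/

noncomputable section

namespace Summit.AtomisticToContinuum.BoseEinsteinCondensation.Theorems.RigidMomentumBound

open MeasureTheory Filter Set
open scoped ENNReal NNReal BigOperators Topology
open Literature.MathematicalPhysics.QuantumManyBody.BoseGas

section Glue
variable
  (hF3 :
    ∀ (v : ℝ → ℝ≥0∞), Measurable v → ∀ R₀ : ℝ, 0 < R₀ → (∀ r, R₀ < r → v r = 0) →
      ∀ (N : ℕ) (L : ℝ), 0 < L → 8 * R₀ ≤ L → (N : ℝ) * R₀ ^ 3 ≤ L ^ 3 / 2000 → groundStateEnergy v (N + 1) L ≤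
      groundStateEnergy v N L + ENNReal.ofReal (120 / L ^ 2 + 13000 * N * R₀ / L ^ 3))
  (hF4 :
    ∀ v : ℝ → ℝ≥0∞, IsRepulsiveFiniteRange v → ∃ ρ₀ : ℝ, 0 < ρ₀ ∧ ∀ ρ : ℝ, 0 < ρ → ρ < ρ₀ →
      ∃ s₁ : ℝ, 0 < s₁ ∧ ∀ s : ℝ, 0 < s → s ≤ s₁ → ∀ θ : ℝ, 0 < θ → ∀ κ : ℝ, 0 < κ →
      ∀ᶠ N : ℕ in atTop, ∀ L' ∈ Set.Icc (sideLength ρ N) ((1 + κ / N) * sideLength ρ N),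
      ∀ Φ : TrialState N L', energy v Φ ≤ groundStateEnergy v N L' + 1 →
      ∀ a : Fin 3, (∑ j : Fin N, ∫⁻ X in {X : Config N | L' - s < X j a},
      (‖Φ.ψ X‖₊ : ℝ≥0∞) ^ 2) ≤ ENNReal.ofReal (θ * N))
  (hF6 :
    ∀ (S μ η E' E₁ : ℝ) (m p et e : ℝ → ℝ), 0 < μ → 0 ≤ η → E' - E₁ ≤ μ → 2 * (Real.pi / (2 * Real.sqrt μ)) ≤ S →
      ContinuousOn m (Set.Icc 0 S) → m 0 = 0 → (∀ s ∈ Set.Icc 0 S, 0 ≤ m s) →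
      IntegrableOn p (Set.Icc 0 S) → IntegrableOn et (Set.Icc 0 S) → IntegrableOn e (Set.Icc 0 S) →
      (∀ s ∈ Set.Icc 0 S, m s = ∫ x in (0 : ℝ)..s, p x) →
      (∀ᵐ s ∂(volume.restrict (Set.Icc 0 S)), 0 ≤ et s ∧ et s ≤ e s ∧ p s ^ 2 ≤ 4 * m s * et s) →
      (∀ g : ℝ → ℝ, ContDiff ℝ 1 g →
      (∫ s in (0 : ℝ)..S, g s * e s) + (1 / 2) * (∫ s in (0 : ℝ)..S, deriv g s * p s) =
      E' * ∫ s in (0 : ℝ)..S, g s * m s) → (∀ g : ℝ → ℝ, ContDiff ℝ 1 g → (∀ s, 0 ≤ g s) →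
      (∫ s in (0 : ℝ)..S, g s * et s) + E₁ * (∫ s in (0 : ℝ)..S, g s * m s) ≤ ∫ s in (0 : ℝ)..S, g s * e s) →
      (∫ s in (0 : ℝ)..(2 * (Real.pi / (2 * Real.sqrt μ))), m s) ≤ η →
      ∀ σ : ℝ, 0 < σ → σ ≤ Real.pi / (2 * Real.sqrt μ) / 2 →
      (∫ s in (0 : ℝ)..σ, et s) ≤ 8 * μ * Real.sqrt μ * η * σ)
  (hG4 :
    ∀ (v : ℝ → ℝ≥0∞), Measurable v → ∀ (n : ℕ) (L : ℝ), 0 < L →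
      groundStateEnergy v (n + 1) L ≠ ⊤ → groundStateEnergy v n L ≠ ⊤ → ∃ (m p et e : Fin 3 → ℝ → ℝ), (∀ a : Fin 3,
      ContinuousOn (m a) (Set.Icc 0 L) ∧ m a 0 = 0 ∧ (∀ s ∈ Set.Icc 0 L, 0 ≤ m a s) ∧
      IntegrableOn (p a) (Set.Icc 0 L) ∧ IntegrableOn (et a) (Set.Icc 0 L) ∧ IntegrableOn (e a) (Set.Icc 0 L) ∧
      (∀ s ∈ Set.Icc 0 L, m a s = ∫ x in (0 : ℝ)..s, p a x) ∧ (∀ᵐ s ∂(volume.restrict (Set.Icc 0 L)),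
      0 ≤ et a s ∧ et a s ≤ e a s ∧ p a s ^ 2 ≤ 4 * m a s * et a s) ∧ (∀ g : ℝ → ℝ, ContDiff ℝ 1 g →
      (∫ s in (0 : ℝ)..L, g s * e a s) + (1 / 2) * (∫ s in (0 : ℝ)..L, deriv g s * p a s) =
      (groundStateEnergy v (n + 1) L).toReal * ∫ s in (0 : ℝ)..L, g s * m a s) ∧
      (∀ g : ℝ → ℝ, ContDiff ℝ 1 g → (∀ s, 0 ≤ g s) → (∫ s in (0 : ℝ)..L, g s * et a s) +
      (groundStateEnergy v n L).toReal * (∫ s in (0 : ℝ)..L, g s * m a s) ≤ ∫ s in (0 : ℝ)..L, g s * e a s) ∧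
      (∀ b ∈ Set.Icc 0 L, ∀ K : ℝ, (∀ Φ : TrialState (n + 1) L, energy v Φ ≤ groundStateEnergy v (n + 1) L + 1 →
      (∫ s in (0 : ℝ)..b, marginalMassReal Φ.ψ ((0 : Fin (n + 1)), a) (L - s)) ≤ K) →
      (∫ s in (0 : ℝ)..b, m a s) ≤ K)) ∧ (∀ σ ∈ Set.Icc 0 L, ∀ θ : ℝ, 0 < θ → ∃ Φ : TrialState (n + 1) L,
      energy v Φ ≤ groundStateEnergy v (n + 1) L + ENNReal.ofReal θ ∧
      ∀ a : Fin 3, (∫ s in (0 : ℝ)..σ, sliceEnergyReal v Φ.ψ ((0 : Fin (n + 1)), a) (L - s)) ≤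
      (∫ s in (0 : ℝ)..σ, e a s) + θ))
  (hG5 :
    ∀ (S E' A s₁ : ℝ) (m p et e : ℝ → ℝ), 0 ≤ E' → 0 ≤ A → 0 < s₁ → s₁ ≤ S →
      ContinuousOn m (Set.Icc 0 S) → m 0 = 0 → (∀ s ∈ Set.Icc 0 S, 0 ≤ m s) →
      IntegrableOn p (Set.Icc 0 S) → IntegrableOn et (Set.Icc 0 S) → IntegrableOn e (Set.Icc 0 S) →
      (∀ s ∈ Set.Icc 0 S, m s = ∫ x in (0 : ℝ)..s, p x) →
      (∀ᵐ s ∂(volume.restrict (Set.Icc 0 S)), 0 ≤ et s ∧ et s ≤ e s ∧ p s ^ 2 ≤ 4 * m s * et s) →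
      (∀ g : ℝ → ℝ, ContDiff ℝ 1 g →
      (∫ s in (0 : ℝ)..S, g s * e s) + (1 / 2) * (∫ s in (0 : ℝ)..S, deriv g s * p s) =
      E' * ∫ s in (0 : ℝ)..S, g s * m s) → (∀ σ : ℝ, 0 < σ → σ ≤ s₁ → (∫ s in (0 : ℝ)..σ, et s) ≤ A * σ) →
      ∀ σ : ℝ, 0 < σ → 2 * σ ≤ s₁ → (∫ s in (0 : ℝ)..σ, e s) ≤ 12 * A * σ + 32 * E' * A * σ ^ 3)

/-! ### Finiteness of the energy at low density from the insertion bound -/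

include hF3 in
/-- Iterating the insertion bound from `E₀(0, L) = 0`: at density `N R₀³ ≤ L³/2000` every
`E₀(k, L)`, `k ≤ N + 1`, is finite. -/
theorem groundStateEnergy_ne_top_of_insertionBound {v : ℝ → ℝ≥0∞}
    (hv : Measurable v) {R₀ : ℝ} (hR₀ : 0 < R₀) (hv0 : ∀ r, R₀ < r → v r = 0) {L : ℝ} (hL : 0 < L)
    (h8 : 8 * R₀ ≤ L) (N : ℕ) (hdens : (N : ℝ) * R₀ ^ 3 ≤ L ^ 3 / 2000) :
    ∀ k : ℕ, k ≤ N + 1 → groundStateEnergy v k L ≠ ⊤ := by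
  intro k
  induction k with
  | zero =>
    intro _
    rw [groundStateEnergy_eq_infEnergy, infEnergy_zero]
    exact ENNReal.zero_ne_top
  | succ k ih =>
    intro hk
    have hk' : k ≤ N + 1 := Nat.le_of_succ_le hk
    have hkN : (k : ℝ) * R₀ ^ 3 ≤ L ^ 3 / 2000 := by
      have : (k : ℝ) ≤ N := by exact_mod_cast Nat.lt_succ_iff.1 hk
      nlinarith [pow_pos hR₀ 3]
    have h := hF3 v hv R₀ hR₀ hv0 k L hL h8 hkN
    exact ne_top_of_le_ne_top (ENNReal.add_ne_top.2 ⟨ih hk', ENNReal.ofReal_ne_top⟩) h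


/-! ### From the slab bound of all particles to the wall-coordinate mass of particle `0` -/

/-- If the total expected number of particles within `s` of the right `a`-wall is `≤ θ(n+1)`, then the
wall-coordinate marginal mass of particle `0` integrates to `≤ θ` over `[0, s]`. [folklore] -/
theorem intervalIntegral_marginal_le_of_slab {n : ℕ} {L : ℝ} (Φ : TrialState (n + 1) L) (a : Fin 3)
    {s θ : ℝ} (hs : 0 ≤ s) (hθ : 0 ≤ θ)
    (h : (∑ j : Fin (n + 1), ∫⁻ X in {X : Config (n + 1) | L - s < X j a}, (‖Φ.ψ X‖₊ : ℝ≥0∞) ^ 2) ≤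
      ENNReal.ofReal (θ * (n + 1 : ℕ))) :
    (∫ x in (0 : ℝ)..s, marginalMassReal Φ.ψ ((0 : Fin (n + 1)), a) (L - x)) ≤ θ := by
  have hsum : (∑ j : Fin (n + 1), ∫⁻ X in {X : Config (n + 1) | L - s < X j a}, (‖Φ.ψ X‖₊ : ℝ≥0∞) ^ 2) =
      ((n + 1 : ℕ) : ℝ≥0∞) * ∫⁻ X in {X : Config (n + 1) | L - s < X (0 : Fin (n + 1)) a},
        (‖Φ.ψ X‖₊ : ℝ≥0∞) ^ 2 := by
    rw [Finset.sum_congr rfl fun j _ => setLIntegral_normSq_coord_eq Φ j 0 a (L - s),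
      Finset.sum_const, Finset.card_univ, Fintype.card_fin, nsmul_eq_mul]
  rw [hsum, ENNReal.ofReal_mul hθ, ENNReal.ofReal_natCast, mul_comm (ENNReal.ofReal θ)] at h
  have hN0 : ((n + 1 : ℕ) : ℝ≥0∞) ≠ 0 := by exact_mod_cast Nat.succ_ne_zero n
  have hNt : ((n + 1 : ℕ) : ℝ≥0∞) ≠ ⊤ := ENNReal.natCast_ne_top _
  have h' : ∫⁻ X in {X : Config (n + 1) | L - s < X (0 : Fin (n + 1)) a}, (‖Φ.ψ X‖₊ : ℝ≥0∞) ^ 2 ≤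
      ENNReal.ofReal θ := (ENNReal.mul_le_mul_iff_right hN0 hNt).1 (by simpa [mul_comm] using h)
  rw [setLIntegral_normSq_eq_ofReal Φ ((0 : Fin (n + 1)), a) hs] at h'
  exact (ENNReal.ofReal_le_ofReal_iff hθ).1 h'

/-! ### The assembly: R3 from F3, F4, F6, G4, G5 -/

/-- Bookkeeping of the constants (pure real arithmetic). With `θ = ερ/(1728κμ√μ)`, `A = 8μ√μθ`,
`θtr = ερw/(9κ)`, `Q = 24Aw + 256E'Aw³ + θtr` and `32(E'+1)w² ≤ 1`: `3(n+1)Q ≤ ερ(n+1)w/κ` and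
`θtr ≤ ερ(n+1)w/κ`. [folklore] -/
theorem nearWall_budget {ε ρ κ μ E' w : ℝ} {m : ℕ} (hε : 0 < ε) (hρ : 0 < ρ) (hκ : 0 < κ)
    (hμ : 0 < μ) (hw : 0 < w) (hw2 : w ^ 2 * (32 * (E' + 1)) ≤ 1) (hm : 1 ≤ (m : ℝ)) :
    3 * (m : ℝ) * (12 * (8 * μ * Real.sqrt μ * (ε * ρ / (1728 * κ * μ * Real.sqrt μ))) * (2 * w) +
        32 * E' * (8 * μ * Real.sqrt μ * (ε * ρ / (1728 * κ * μ * Real.sqrt μ))) * (2 * w) ^ 3 +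
        ε * ρ * w / (9 * κ)) ≤ ε * ρ * m * w / κ ∧
      ε * ρ * w / (9 * κ) ≤ ε * ρ * m * w / κ := by
  have hsμ : 0 < Real.sqrt μ := Real.sqrt_pos.2 hμ
  have hA : 8 * μ * Real.sqrt μ * (ε * ρ / (1728 * κ * μ * Real.sqrt μ)) = ε * ρ / (216 * κ) := by
    field_simp; ring
  rw [hA]
  have hE'w : 32 * (E' * w ^ 2) ≤ 1 := by
    have := hw2; ring_nf at this ⊢; nlinarith [sq_nonneg w]
  have hunit : 0 < ε * ρ * w / κ := by positivity
  constructor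
  · have hexp : 3 * (m : ℝ) * (12 * (ε * ρ / (216 * κ)) * (2 * w) +
        32 * E' * (ε * ρ / (216 * κ)) * (2 * w) ^ 3 + ε * ρ * w / (9 * κ)) =
        (m : ℝ) * (ε * ρ * w / κ) * (2 / 3 + 32 / 9 * (E' * w ^ 2)) := by
      field_simp; ring
    rw [hexp]
    have h1 : 2 / 3 + 32 / 9 * (E' * w ^ 2) ≤ 1 := by nlinarith
    calc (m : ℝ) * (ε * ρ * w / κ) * (2 / 3 + 32 / 9 * (E' * w ^ 2))
        ≤ (m : ℝ) * (ε * ρ * w / κ) * 1 := by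
          apply mul_le_mul_of_nonneg_left h1; positivity
      _ = ε * ρ * m * w / κ := by ring
  · rw [div_le_div_iff₀ (by positivity) hκ]
    have h0 : 0 ≤ ε * ρ * w := by positivity
    nlinarith [mul_le_mul_of_nonneg_left hm h0]

include hF6 hG4 hG5 in
/-- **The fixed-box step.** In a box `L'` with finite energies of `n` and `n+1` particles, given the
limit package, the Sturm package, the full-slice-energy bound, the chemical-potential bound `E'-E₁ ≤ μ`,
the slab bound at width `2s₀` with tolerance `θ`, and `2s₀ ≤ L'`, every small `w` admits a near-minimiser
with small near-wall energy. [folklore] -/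
theorem nearWall_fixed_box
    {v : ℝ → ℝ≥0∞} (hv : Measurable v) {n : ℕ} {L' μ θ B : ℝ} (hL' : 0 < L') (hμ : 0 < μ) (hθ : 0 < θ)
    (hB : 0 < B)
    (hfinN : groundStateEnergy v (n + 1) L' ≠ ⊤) (hfinn : groundStateEnergy v n L' ≠ ⊤)
    (hE'E₁ : (groundStateEnergy v (n + 1) L').toReal - (groundStateEnergy v n L').toReal ≤ μ)
    (h2s₀ : 2 * (Real.pi / (2 * Real.sqrt μ)) ≤ L')
    (hslab : ∀ Φ : TrialState (n + 1) L', energy v Φ ≤ groundStateEnergy v (n + 1) L' + 1 →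
      ∀ a : Fin 3, (∑ j : Fin (n + 1), ∫⁻ X in {X : Config (n + 1) | L' - 2 * (Real.pi / (2 * Real.sqrt μ)) < X j a},
        (‖Φ.ψ X‖₊ : ℝ≥0∞) ^ 2) ≤ ENNReal.ofReal (θ * (n + 1 : ℕ)))
    (hbudget : ∀ w : ℝ, 0 < w → w ^ 2 * (32 * ((groundStateEnergy v (n + 1) L').toReal + 1)) ≤ 1 →
      3 * ((n + 1 : ℕ) : ℝ) * (12 * (8 * μ * Real.sqrt μ * θ) * (2 * w) +
        32 * (groundStateEnergy v (n + 1) L').toReal * (8 * μ * Real.sqrt μ * θ) * (2 * w) ^ 3 +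
          B * w / 9) ≤ B * (n + 1 : ℕ) * w ∧ B * w / 9 ≤ B * (n + 1 : ℕ) * w) :
    ∃ w₀ : ℝ, 0 < w₀ ∧ ∀ w ∈ Set.Ioc (0 : ℝ) w₀, ∃ u : TrialState (n + 1) L',
      energy v u ≤ groundStateEnergy v (n + 1) L' + ENNReal.ofReal (B * (n + 1 : ℕ) * w) ∧
      (∑ j : Fin (n + 1), ∑ a : Fin 3, ∫⁻ X in {X : Config (n + 1) | L' - 2 * w < X j a},
          (kineticDensity u.ψ X + interaction v X * (‖u.ψ X‖₊ : ℝ≥0∞) ^ 2)) ≤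
        ENNReal.ofReal (B * (n + 1 : ℕ) * w) := by
  have hE'nn : 0 ≤ (groundStateEnergy v (n + 1) L').toReal := ENNReal.toReal_nonneg
  have hs₀pos : 0 < Real.pi / (2 * Real.sqrt μ) := by positivity
  obtain ⟨m, p, et, e, hdata, htr⟩ := hG4 v hv n L' hL' hfinN hfinn
  have hAnn : 0 ≤ 8 * μ * Real.sqrt μ * θ := by positivity
  -- F6 per direction
  have hEt : ∀ a : Fin 3, ∀ σ' : ℝ, 0 < σ' → σ' ≤ Real.pi / (2 * Real.sqrt μ) / 2 →
      (∫ s in (0 : ℝ)..σ', et a s) ≤ 8 * μ * Real.sqrt μ * θ * σ' := by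
    intro a σ' hσ' hσ's
    obtain ⟨hC1, h0, hnn, hIp, hIet, hIe, hC3, hC4, hC5, hC6, hC7⟩ := hdata a
    have hmass : (∫ s in (0 : ℝ)..(2 * (Real.pi / (2 * Real.sqrt μ))), m a s) ≤ θ :=
      hC7 (2 * (Real.pi / (2 * Real.sqrt μ))) ⟨by positivity, h2s₀⟩ θ fun Φ hΦ =>
        intervalIntegral_marginal_le_of_slab Φ a (by positivity) hθ.le (hslab Φ hΦ a)
    exact hF6 L' μ θ _ _ (m a) (p a) (et a) (e a) hμ hθ.le hE'E₁ h2s₀ hC1 h0 hnn hIp hIet hIe hC3 hC4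
      hC5 hC6 hmass σ' hσ' hσ's
  refine ⟨min (Real.pi / (2 * Real.sqrt μ) / 8)
      (min (1 / Real.sqrt (32 * ((groundStateEnergy v (n + 1) L').toReal + 1))) (L' / 4)),
    by positivity, fun w hw => ?_⟩
  have hw0 : 0 < w := hw.1
  have hws₀ : w ≤ Real.pi / (2 * Real.sqrt μ) / 8 := hw.2.trans (min_le_left _ _)
  have hwE : w ≤ 1 / Real.sqrt (32 * ((groundStateEnergy v (n + 1) L').toReal + 1)) :=
    hw.2.trans ((min_le_right _ _).trans (min_le_left _ _))
  have hwL : w ≤ L' / 4 := hw.2.trans ((min_le_right _ _).trans (min_le_right _ _))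
  have hw2 : w ^ 2 * (32 * ((groundStateEnergy v (n + 1) L').toReal + 1)) ≤ 1 := by
    have hs : 0 < Real.sqrt (32 * ((groundStateEnergy v (n + 1) L').toReal + 1)) :=
      Real.sqrt_pos.2 (by positivity)
    have h1 : w * Real.sqrt (32 * ((groundStateEnergy v (n + 1) L').toReal + 1)) ≤ 1 := by
      rwa [le_div_iff₀ hs] at hwE
    have h2 : 0 ≤ w * Real.sqrt (32 * ((groundStateEnergy v (n + 1) L').toReal + 1)) := by positivity
    calc w ^ 2 * (32 * ((groundStateEnergy v (n + 1) L').toReal + 1))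
        = (w * Real.sqrt (32 * ((groundStateEnergy v (n + 1) L').toReal + 1))) ^ 2 := by
          rw [mul_pow, Real.sq_sqrt (by positivity)]
      _ ≤ 1 := by nlinarith
  obtain ⟨hQ, hθtr⟩ := hbudget w hw0 hw2
  -- G5 per direction at `σ = 2w`
  have hEfull : ∀ a : Fin 3, (∫ s in (0 : ℝ)..(2 * w), e a s) ≤
      12 * (8 * μ * Real.sqrt μ * θ) * (2 * w) +
        32 * (groundStateEnergy v (n + 1) L').toReal * (8 * μ * Real.sqrt μ * θ) * (2 * w) ^ 3 := by
    intro a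
    obtain ⟨hC1, h0, hnn, hIp, hIet, hIe, hC3, hC4, hC5, -, -⟩ := hdata a
    exact hG5 L' _ _ (Real.pi / (2 * Real.sqrt μ) / 2) (m a) (p a) (et a) (e a) hE'nn hAnn
      (by positivity) (by linarith) hC1 h0 hnn hIp hIet hIe hC3 hC4 hC5 (hEt a) (2 * w)
      (by positivity) (by linarith)
  -- transfer
  have hθtrpos : 0 < B * w / 9 := by positivity
  obtain ⟨Φ, hΦE, hΦe⟩ := htr (2 * w) ⟨by positivity, by linarith⟩ (B * w / 9) hθtrpos
  have hfinΦ : energy v Φ ≠ ⊤ :=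
    ne_top_of_le_ne_top (ENNReal.add_ne_top.2 ⟨hfinN, ENNReal.ofReal_ne_top⟩) hΦE
  refine ⟨Φ, hΦE.trans (add_le_add le_rfl (ENNReal.ofReal_le_ofReal hθtr)), ?_⟩
  have hterm : ∀ a : Fin 3, ∫⁻ X in {X : Config (n + 1) | L' - 2 * w < X (0 : Fin (n + 1)) a},
      (kineticDensity Φ.ψ X + interaction v X * (‖Φ.ψ X‖₊ : ℝ≥0∞) ^ 2) ≤
      ENNReal.ofReal (12 * (8 * μ * Real.sqrt μ * θ) * (2 * w) +
        32 * (groundStateEnergy v (n + 1) L').toReal * (8 * μ * Real.sqrt μ * θ) * (2 * w) ^ 3 +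
          B * w / 9) := by
    intro a
    rw [setLIntegral_energyDensity_eq_ofReal hv Φ hfinΦ ((0 : Fin (n + 1)), a) (by positivity)]
    refine ENNReal.ofReal_le_ofReal ?_
    linarith [hΦe a, hEfull a]
  calc (∑ j : Fin (n + 1), ∑ a : Fin 3, ∫⁻ X in {X : Config (n + 1) | L' - 2 * w < X j a},
          (kineticDensity Φ.ψ X + interaction v X * (‖Φ.ψ X‖₊ : ℝ≥0∞) ^ 2))
      = ∑ j : Fin (n + 1), ∑ a : Fin 3, ∫⁻ X in {X : Config (n + 1) | L' - 2 * w < X (0 : Fin (n + 1)) a},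
          (kineticDensity Φ.ψ X + interaction v X * (‖Φ.ψ X‖₊ : ℝ≥0∞) ^ 2) := by
        refine Finset.sum_congr rfl fun j _ => Finset.sum_congr rfl fun a _ => ?_
        exact setLIntegral_energyDensity_coord_eq v hv Φ j 0 a (L' - 2 * w)
    _ ≤ ∑ j : Fin (n + 1), ∑ a : Fin 3, ENNReal.ofReal (12 * (8 * μ * Real.sqrt μ * θ) * (2 * w) +
          32 * (groundStateEnergy v (n + 1) L').toReal * (8 * μ * Real.sqrt μ * θ) * (2 * w) ^ 3 +
            B * w / 9) := by
        gcongr with j _ a _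
        exact hterm a
    _ = ENNReal.ofReal (3 * (n + 1 : ℕ) * (12 * (8 * μ * Real.sqrt μ * θ) * (2 * w) +
          32 * (groundStateEnergy v (n + 1) L').toReal * (8 * μ * Real.sqrt μ * θ) * (2 * w) ^ 3 +
            B * w / 9)) := by
        simp only [Finset.sum_const, Finset.card_univ, Fintype.card_fin, nsmul_eq_mul]
        rw [ENNReal.ofReal_mul (by positivity), ENNReal.ofReal_mul (by norm_num),
          ENNReal.ofReal_natCast, show ENNReal.ofReal 3 = (3 : ℕ) by norm_num]
        push_cast
        ring
    _ ≤ ENNReal.ofReal (B * (n + 1 : ℕ) * w) := ENNReal.ofReal_le_ofReal hQ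

include hF3 hF4 hF6 hG4 hG5 in
/-- **The glue (F7, lead).** The near-wall energy bound R3 from the five
inputs: insertion bound (F3), slab non-concentration (F4), the Sturm package (F6), the marginal limit
package (G4) and the full-slice-energy post-processing (G5). Constants: `ρ₀ := min ρ₄ (1/(2000R₀³))`,
`μ := max (13000ρR₀+2) (π²/s₁²+1)`, `s₀ := π/(2√μ)`, `θ := ερ/(1728κμ√μ)`, `A := 8μ√μθ`,
`w₀ := min (s₀/8) (min (1/√(32(E'+1))) (L'/4))`; eventualities: F4 at `(2s₀, θ, κ)`,
`L_N ≥ max (max 8R₀ 2s₀) √120`, `N ≥ 2`. -/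
theorem nearWallGlue :
    ∀ v : ℝ → ℝ≥0∞, IsRepulsiveFiniteRange v → ∃ ρ₀ : ℝ, 0 < ρ₀ ∧ ∀ ρ : ℝ, 0 < ρ → ρ < ρ₀ →
      ∀ ε : ℝ, 0 < ε → ∀ κ : ℝ, 0 < κ → ∀ᶠ N : ℕ in atTop,
        ∀ L' ∈ Set.Icc (sideLength ρ N) ((1 + κ / N) * sideLength ρ N),
          ∃ w₀ : ℝ, 0 < w₀ ∧ ∀ w ∈ Set.Ioc (0 : ℝ) w₀, ∃ u : TrialState N L',
            energy v u ≤ groundStateEnergy v N L' +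
                ENNReal.ofReal (ε * N ^ 2 * w / (κ * sideLength ρ N ^ 3)) ∧
            (∑ j : Fin N, ∑ a : Fin 3, ∫⁻ X in {X : Config N | L' - 2 * w < X j a},
                (kineticDensity u.ψ X + interaction v X * (‖u.ψ X‖₊ : ℝ≥0∞) ^ 2)) ≤
              ENNReal.ofReal (ε * N ^ 2 * w / (κ * sideLength ρ N ^ 3)) := by
  intro v hv
  obtain ⟨R₀, hR₀, hv0⟩ := hv.exists_pos_range
  obtain ⟨ρ₄, hρ₄, h4⟩ := hF4 v hv
  refine ⟨min ρ₄ (1 / (2000 * R₀ ^ 3)), lt_min hρ₄ (by positivity), fun ρ hρ hρlt ε hε κ hκ => ?_⟩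
  have hρ₄' : ρ < ρ₄ := hρlt.trans_le (min_le_left _ _)
  have hρR : ρ * R₀ ^ 3 ≤ 1 / 2000 := by
    have := (hρlt.trans_le (min_le_right _ _)).le
    rw [le_div_iff₀ (by positivity)] at this
    linarith
  obtain ⟨s₁, hs₁, h4'⟩ := h4 ρ hρ hρ₄'
  -- the comparison constant `μ` and the slab tolerance `θ`
  obtain ⟨μ, hμdef⟩ : ∃ μ : ℝ, μ = max (13000 * ρ * R₀ + 2) (Real.pi ^ 2 / s₁ ^ 2 + 1) := ⟨_, rfl⟩
  have hμpos : 0 < μ := by rw [hμdef]; exact lt_max_of_lt_left (by positivity)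
  have hμ1 : 13000 * ρ * R₀ + 2 ≤ μ := by rw [hμdef]; exact le_max_left _ _
  have hμ2 : Real.pi ^ 2 / s₁ ^ 2 + 1 ≤ μ := by rw [hμdef]; exact le_max_right _ _
  have hs₀pos : 0 < Real.pi / (2 * Real.sqrt μ) := by positivity
  have h2s₀ : 2 * (Real.pi / (2 * Real.sqrt μ)) ≤ s₁ := by
    have hsq : Real.pi / s₁ ≤ Real.sqrt μ := by
      refine Real.le_sqrt_of_sq_le ?_
      have : (Real.pi / s₁) ^ 2 = Real.pi ^ 2 / s₁ ^ 2 := by rw [div_pow]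
      linarith
    have hps : 0 < Real.pi / s₁ := by positivity
    calc 2 * (Real.pi / (2 * Real.sqrt μ)) = Real.pi / Real.sqrt μ := by field_simp
      _ ≤ Real.pi / (Real.pi / s₁) := div_le_div_of_nonneg_left Real.pi_pos.le hps hsq
      _ = s₁ := by field_simp
  obtain ⟨θ, hθdef⟩ : ∃ θ : ℝ, θ = ε * ρ / (1728 * κ * μ * Real.sqrt μ) := ⟨_, rfl⟩
  have hθpos : 0 < θ := by rw [hθdef]; positivity
  have hF4ev := h4' (2 * (Real.pi / (2 * Real.sqrt μ))) (by positivity) h2s₀ θ hθpos κ hκ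
  have hLev : ∀ᶠ N : ℕ in atTop,
      max (max (8 * R₀) (2 * (Real.pi / (2 * Real.sqrt μ)))) (Real.sqrt 120) ≤ sideLength ρ N :=
    (tendsto_sideLength_atTop hρ).eventually_ge_atTop _
  filter_upwards [hF4ev, hLev, eventually_ge_atTop 2] with N hN4 hNL hN2
  obtain ⟨n, rfl⟩ : ∃ n, N = n + 1 := ⟨N - 1, by omega⟩
  intro L' hL'
  have hNpos : 0 < n + 1 := Nat.succ_pos n
  have hLpos : 0 < sideLength ρ (n + 1) := sideLength_pos_of_pos hρ hNpos
  have hLL' : sideLength ρ (n + 1) ≤ L' := hL'.1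
  have hL'pos : 0 < L' := hLpos.trans_le hLL'
  have h8R : 8 * R₀ ≤ L' := (((le_max_left _ _).trans (le_max_left _ _)).trans hNL).trans hLL'
  have h2s₀L : 2 * (Real.pi / (2 * Real.sqrt μ)) ≤ L' :=
    (((le_max_right _ _).trans (le_max_left _ _)).trans hNL).trans hLL'
  have h120 : Real.sqrt 120 ≤ L' := ((le_max_right _ _).trans hNL).trans hLL'
  have hL3 : sideLength ρ (n + 1) ^ 3 = (n + 1 : ℕ) / ρ := sideLength_pow_three hρ (n + 1)
  have hρL3 : ρ * sideLength ρ (n + 1) ^ 3 = (n + 1 : ℕ) := by rw [hL3]; field_simp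
  have hL3' : sideLength ρ (n + 1) ^ 3 ≤ L' ^ 3 := pow_le_pow_left₀ hLpos.le hLL' 3
  have hdens : ((n : ℕ) : ℝ) * R₀ ^ 3 ≤ L' ^ 3 / 2000 := by
    have h1 : ((n : ℕ) : ℝ) ≤ (n + 1 : ℕ) := by exact_mod_cast Nat.le_succ n
    calc ((n : ℕ) : ℝ) * R₀ ^ 3 ≤ (n + 1 : ℕ) * R₀ ^ 3 := by gcongr
      _ = ρ * R₀ ^ 3 * sideLength ρ (n + 1) ^ 3 := by rw [← hρL3]; ring
      _ ≤ 1 / 2000 * L' ^ 3 := by gcongr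
      _ = L' ^ 3 / 2000 := by ring
  have hfin := groundStateEnergy_ne_top_of_insertionBound hF3 hv.1 hR₀ hv0 hL'pos h8R n hdens
  have hfinN : groundStateEnergy v (n + 1) L' ≠ ⊤ := hfin (n + 1) le_rfl
  have hfinn : groundStateEnergy v n L' ≠ ⊤ := hfin n (Nat.le_succ n)
  -- chemical-potential bound
  have hE'E₁ : (groundStateEnergy v (n + 1) L').toReal - (groundStateEnergy v n L').toReal ≤ μ := by
    have h := hF3 v hv.1 R₀ hR₀ hv0 n L' hL'pos h8R hdens
    have hb0 : 0 ≤ 120 / L' ^ 2 + 13000 * n * R₀ / L' ^ 3 := by positivity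
    have h' : (groundStateEnergy v (n + 1) L').toReal ≤
        (groundStateEnergy v n L').toReal + (120 / L' ^ 2 + 13000 * n * R₀ / L' ^ 3) := by
      have := ENNReal.toReal_mono (ENNReal.add_ne_top.2 ⟨hfinn, ENNReal.ofReal_ne_top⟩) h
      rwa [ENNReal.toReal_add hfinn ENNReal.ofReal_ne_top, ENNReal.toReal_ofReal hb0] at this
    have hb1 : 120 / L' ^ 2 ≤ 1 := by
      rw [div_le_one (by positivity)]
      have : (120 : ℝ) = Real.sqrt 120 ^ 2 := (Real.sq_sqrt (by norm_num)).symm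
      rw [this]
      exact pow_le_pow_left₀ (Real.sqrt_nonneg _) h120 2
    have hb2 : 13000 * n * R₀ / L' ^ 3 ≤ 13000 * ρ * R₀ := by
      rw [div_le_iff₀ (by positivity)]
      have : (n : ℝ) ≤ ρ * L' ^ 3 := by
        have h1 : ((n : ℕ) : ℝ) ≤ (n + 1 : ℕ) := by exact_mod_cast Nat.le_succ n
        calc (n : ℝ) ≤ (n + 1 : ℕ) := h1
          _ = ρ * sideLength ρ (n + 1) ^ 3 := hρL3.symm
          _ ≤ ρ * L' ^ 3 := by gcongr
      nlinarith [hR₀]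
    linarith
  -- apply the fixed-box step with `B = ερ/κ`
  have hB : 0 < ε * ρ / κ := by positivity
  have hbudget := fun w (hw0 : 0 < w)
      (hw2 : w ^ 2 * (32 * ((groundStateEnergy v (n + 1) L').toReal + 1)) ≤ 1) =>
    nearWall_budget (m := n + 1) hε hρ hκ hμpos hw0 hw2 (by exact_mod_cast hNpos)
  obtain ⟨w₀, hw₀, hmain⟩ := nearWall_fixed_box hF6 hG4 hG5 hv.1 hL'pos hμpos hθpos hB hfinN hfinn
    hE'E₁ h2s₀L (fun Φ hΦ a => hN4 L' hL' Φ hΦ a) (fun w hw0 hw2 => by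
      have := hbudget w hw0 hw2
      rw [hθdef]
      constructor
      · convert this.1 using 2 <;> ring
      · convert this.2 using 1 <;> ring)
  refine ⟨w₀, hw₀, fun w hw => ?_⟩
  obtain ⟨u, hu1, hu2⟩ := hmain w hw
  have hconv : ENNReal.ofReal (ε * ρ / κ * (n + 1 : ℕ) * w) =
      ENNReal.ofReal (ε * (n + 1 : ℕ) ^ 2 * w / (κ * sideLength ρ (n + 1) ^ 3)) := by
    congr 1
    rw [hL3]; field_simp
  rw [hconv] at hu1 hu2
  exact ⟨u, hu1, hu2⟩
end Glue

/-- **R3 `stub_nearWallEnergy`** (the line's load-bearing statement; the wall flux is `o(N)`): the glue applied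
to the landed stubs F3 (with F1), F4, F6, G4 (= G4x applied to G4b) and G5. -/
theorem stub_nearWallEnergy :
    ∀ v : ℝ → ℝ≥0∞, IsRepulsiveFiniteRange v → ∃ ρ₀ : ℝ, 0 < ρ₀ ∧ ∀ ρ : ℝ, 0 < ρ → ρ < ρ₀ →
      ∀ ε : ℝ, 0 < ε → ∀ κ : ℝ, 0 < κ → ∀ᶠ N : ℕ in atTop,
        ∀ L' ∈ Set.Icc (sideLength ρ N) ((1 + κ / N) * sideLength ρ N),
          ∃ w₀ : ℝ, 0 < w₀ ∧ ∀ w ∈ Set.Ioc (0 : ℝ) w₀, ∃ u : TrialState N L',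
            energy v u ≤ groundStateEnergy v N L' +
                ENNReal.ofReal (ε * N ^ 2 * w / (κ * sideLength ρ N ^ 3)) ∧
            (∑ j : Fin N, ∑ a : Fin 3, ∫⁻ X in {X : Config N | L' - 2 * w < X j a},
                (kineticDensity u.ψ X + interaction v X * (‖u.ψ X‖₊ : ℝ≥0∞) ^ 2)) ≤
              ENNReal.ofReal (ε * N ^ 2 * w / (κ * sideLength ρ N ^ 3)) :=
  nearWallGlue (stub_insertionBound stub_firstVariation) stub_slabNonConcentration stub_sturmPackage
    (stub_marginalLimitExtraction stub_sliceStability) stub_fullSliceEnergy1D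

end Summit.AtomisticToContinuum.BoseEinsteinCondensation.Theorems.RigidMomentumBound

end
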